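import Summits.NavierStokesRegularity.NavierStokesRegularity.Theses.AxisymmetricExtremality
import Summits.NavierStokesRegularity.NavierStokesRegularity.Theorems.AxisymmetricExtremalityMinimalDatumPFoldThresholdFinite
import Summits.NavierStokesRegularity.NavierStokesRegularity.Theorems.AxisymmetricExtremalityMinimalDatumPFoldNotAeZero
import Summits.NavierStokesRegularity.NavierStokesRegularity.Theorems.AxisymmetricExtremalityMinimalDatumPFoldRecentre
import Summits.NavierStokesRegularity.NavierStokesRegularity.Theorems.AxisymmetricExtremalityMinimalDatumPFoldAeToExact
import Summits.NavierStokesRegularity.NavierStokesRegularity.Theorems.AxisymmetricExtremalityMinimalDatumPFoldNearMinimalLimit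
import Summits.NavierStokesRegularity.NavierStokesRegularity.Theorems.AxisymmetricExtremalityMinimalDatumPFoldSymmetryDefectInLimit

/-!
# Route AxisymmetricExtremality — crux `MinimalDatumPFold` (stmt-NavierStokesRegularity-15452): the split D1,
# glue AND the provable child PROVED

The crux-strategist's typed split (`Cruxes/MinimalDatumPFold/StrategySplit.lean`, `STRATEGY-CENSUS.md`
§ Decomposition, evidence `children-D1.json` on the item):

  `MinimalDatumPFold ⇐ SymmGapClosing ∧ SymmThresholdAttained`,

children WRITTEN OUT (no `def`):

* child 1 `SymmGapClosing` (OPEN — the whole open content of the crux, infimum form of the extremality of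
  symmetry; = the registered stub `stub_symmGapClosing` of line `symmetric-gap`): Clay failure at `ν` ⇒
  `∀ N ∃ p ≥ max(N,2) ∀ ε > 0` an a.e.-`R_{2π/p}`-equivariant blow-up datum of norm `< ρ_max^pure ν + ε`;
* child 2 `SymmThresholdAttained` — PROVED HERE (`symmThresholdAttained`): for `ν > 0` with
  `ρ_max^pure ν < ⊤` and `p ≥ 2`, such an `ε`-family yields an exactly `R_{2π/p}`-equivariant MINIMAL
  blow-up datum — composition of the landed stubs `stub_nearMinimalLimit` (attainment modulo `Sim`,
  Rusin–Šverák weak-limit blow-up + Radon–Riesz), `stub_minimalDatum_not_aeZero`,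
  `stub_symmetryDefectInLimit` (symmetry survives modulated `L³`-limits up to a horizontal shift),
  `stub_liftRecentre`, `stub_liftAeToExact`;
* glue `minimalDatumPFold_of_subs : child₁ → child₂ → MinimalDatumPFold` (shape `C₁ → C₂ → C` for
  `ledger route edit --split MinimalDatumPFold --glue-by …Theorems.minimalDatumPFold_of_subs`; uses the landed
  front end `stub_thresholdFinite_of_clayFailure`), and the easy converse
  `symmGapClosing_of_minimalDatumPFold : MinimalDatumPFold → child₁`.

So after the split, child 2 closes by `symmThresholdAttained` (its statement unfolds to this theorem's type)
and child 1 is the residual crux. References: W. Rusin, V. Šverák, J. Funct. Anal. 260 (2011),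
arXiv:0911.0500 Cor. 4.3 and §1 p. 3 [RusinSverak2011]; I. Gallagher, G. Koch, F. Planchon, arXiv:1012.0145
Thm. 9 [GallagherKochPlanchon2013].
-/

set_option linter.dupNamespace false

namespace Summit.NavierStokesRegularity.NavierStokesRegularity.Theorems

/-- **Child 2 of the split, `SymmThresholdAttained`, PROVED.** For `ν > 0` with `ρ_max^pure(ν) < ⊤` and
`p ≥ 2`: if for every `ε > 0` there is a blow-up datum (`L³`, represented in `Ḣ^{1/2}`, weakly
divergence-free, no global Kato solution) of norm `< ρ_max^pure(ν) + ε` which is a.e. equivariant under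
`R_{2π/p}` about the `x₂`-axis, then there is an exactly `R_{2π/p}`-equivariant Rusin–Šverák minimal
blow-up datum. Proof: take `ε = 1/(k+1)`; `stub_nearMinimalLimit` modulates by `Sim` and extracts an
`L³`-limit `(u, g) ∈ M` along a subsequence; `u` is not a.e. zero (`stub_minimalDatum_not_aeZero`);
`stub_symmetryDefectInLimit` gives `u (R x − x₁) = R (u x)` a.e. with `x₁` horizontal;
`stub_liftRecentre` recentres the axis; `stub_liftAeToExact` makes the equivariance exact.
[cite: RusinSverak2011, Cor. 4.3 and its proof (arXiv:0911.0500 p. 8), §1 p. 3] -/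
theorem symmThresholdAttained :
    ∀ ν : ℝ, 0 < ν → Literature.Analysis.FluidPDE.rusinSverakRhoMaxPure ν < ⊤ → ∀ p : ℕ, 2 ≤ p → (∀ ε : ENNReal, 0 < ε → ∃ (u₀ : EuclideanSpace ℝ (Fin 3) → EuclideanSpace ℝ (Fin 3)) (g : Literature.Analysis.FunctionSpaces.HomSobolev (EuclideanSpace ℝ (Fin 3)) (EuclideanSpace ℂ (Fin 3)) (1 / 2 : ℝ)), MeasureTheory.MemLp u₀ 3 (MeasureTheory.volume : MeasureTheory.Measure (EuclideanSpace ℝ (Fin 3))) ∧ g.Represents (Literature.Analysis.FunctionSpaces.EuclideanSpace.complexify ∘ u₀) ∧ Literature.Analysis.FluidPDE.IsWeaklyDivFree u₀ ∧ ¬ Literature.Analysis.FluidPDE.HasGlobalKatoSolution ν u₀ ∧ ‖g‖ₑ < Literature.Analysis.FluidPDE.rusinSverakRhoMaxPure ν + ε ∧ ∀ᵐ x ∂(MeasureTheory.volume : MeasureTheory.Measure (EuclideanSpace ℝ (Fin 3))), u₀ (WithLp.toLp 2 ![Real.cos (2 * Real.pi / p) * x 0 - Real.sin (2 * Real.pi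 / p) * x 1, Real.sin (2 * Real.pi / p) * x 0 + Real.cos (2 * Real.pi / p) * x 1, x 2]) = WithLp.toLp 2 ![Real.cos (2 * Real.pi / p) * u₀ x 0 - Real.sin (2 * Real.pi / p) * u₀ x 1, Real.sin (2 * Real.pi / p) * u₀ x 0 + Real.cos (2 * Real.pi / p) * u₀ x 1, u₀ x 2]) → ∃ (u₀ : EuclideanSpace ℝ (Fin 3) → EuclideanSpace ℝ (Fin 3)) (g : Literature.Analysis.FunctionSpaces.HomSobolev (EuclideanSpace ℝ (Fin 3)) (EuclideanSpace ℂ (Fin 3)) (1 / 2 : ℝ)), Literature.Analysis.FluidPDE.IsMinimalBlowupDatum ν u₀ g ∧ ∀ x : EuclideanSpace ℝ (Fin 3), u₀ (WithLp.toLp 2 ![Real.cos (2 * Real.pi / p) * x 0 - Real.sin (2 * Real.pi / p) * x 1, Real.sin (2 * Real.pi / p) * x 0 + Real.cos (2 * Real.pi / p) * x 1, x 2]) = WithLp.toLp 2 ![Real.cos (2 * Real.pi / p) * u₀ x 0 - Real.sin (2 * Real.pi / p) * u₀ x 1, Real.sin (2 * Real.pi / p) * u₀ x 0 + Real.cos (2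 * Real.pi / p) * u₀ x 1, u₀ x 2] := by
  intro ν hν hfin p h2p hfam
  have hpos : ∀ k : ℕ, (0 : ENNReal) < ((k : ENNReal) + 1)⁻¹ := fun k =>
    ENNReal.inv_pos.2 (by simp)
  choose U G hU using fun k : ℕ => hfam (((k : ENNReal) + 1)⁻¹) (hpos k)
  obtain ⟨lam, x₀, φ, u, g, hlam, _hφ, hmin, htend⟩ := stub_nearMinimalLimit ν hν hfin U G
    (fun k => ⟨(hU k).1, (hU k).2.1, (hU k).2.2.1, (hU k).2.2.2.1, (hU k).2.2.2.2.1⟩)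
  have hne := stub_minimalDatum_not_aeZero ν u g hmin
  have hL3 : MeasureTheory.MemLp u 3 (MeasureTheory.volume : MeasureTheory.Measure (EuclideanSpace ℝ (Fin 3))) := by
    obtain ⟨h3, -, -, -, -⟩ := hmin
    exact h3
  obtain ⟨x₁, hx₁, hfix⟩ := stub_symmetryDefectInLimit p (fun j => U (φ j)) lam x₀ u (fun j => (hU (φ j)).1)
    (fun j => (hU (φ j)).2.2.2.2.2) hlam hL3 hne htend
  obtain ⟨u₁, g₁, hmin₁, hfix₁⟩ := stub_liftRecentre ν p h2p u g hmin x₁ hx₁ hfix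
  exact stub_liftAeToExact ν p h2p u₁ g₁ hmin₁ hfix₁

/-- **Glue of the split (D1).** `SymmGapClosing → SymmThresholdAttained → MinimalDatumPFold`, children written
out (shape `C₁ → C₂ → C`): the front end `stub_thresholdFinite_of_clayFailure` gives `ρ_max^pure ν < ⊤`, child 1
gives `p` and the `ε`-family, child 2 the exactly equivariant minimal datum. (Verbatim the strategist's
`Cruxes/MinimalDatumPFold/StrategySplit.lean`.) [cite: RusinSverak2011, Cor. 4.3 (arXiv:0911.0500 p. 8)] -/
theorem minimalDatumPFold_of_subs :
    (∀ ν : ℝ, 0 < ν → (∃ v₀ : EuclideanSpace ℝ (Fin 3) → EuclideanSpace ℝ (Fin 3), ContDiff ℝ (⊤ : ℕ∞) v₀ ∧ Literature.Analysis.FluidPDE.NSWave0.IsDivFree v₀ ∧ Literature.Analysis.FluidPDE.HasRapidSpatialDecay v₀ ∧ ¬ ∃ (u : ℝ → EuclideanSpace ℝ (Fin 3) → EuclideanSpace ℝ (Fin 3)) (p : ℝ → EuclideanSpace ℝ (Fin 3) → ℝ), Literature.Analysis.FluidPDE.IsSmoothOnHalfSpace u ∧ Literature.Analysis.FluidPDE.IsSmoothOnHalfSpace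 p ∧ Literature.Analysis.FluidPDE.IsNavierStokesSolution ν 0 v₀ u p ∧ Literature.Analysis.FluidPDE.HasBoundedEnergy u) → ∀ N : ℕ, ∃ p : ℕ, N ≤ p ∧ 2 ≤ p ∧ ∀ ε : ENNReal, 0 < ε → ∃ (u₀ : EuclideanSpace ℝ (Fin 3) → EuclideanSpace ℝ (Fin 3)) (g : Literature.Analysis.FunctionSpaces.HomSobolev (EuclideanSpace ℝ (Fin 3)) (EuclideanSpace ℂ (Fin 3)) (1 / 2 : ℝ)), MeasureTheory.MemLp u₀ 3 (MeasureTheory.volume : MeasureTheory.Measure (EuclideanSpace ℝ (Fin 3))) ∧ g.Represents (Literature.Analysis.FunctionSpaces.EuclideanSpace.complexify ∘ u₀) ∧ Literature.Analysis.FluidPDE.IsWeaklyDivFree u₀ ∧ ¬ Literature.Analysis.FluidPDE.HasGlobalKatoSolution ν u₀ ∧ ‖g‖ₑ < Literature.Analysis.FluidPDE.rusinSverakRhoMaxPure ν + ε ∧ ∀ᵐ x ∂(MeasureTheory.volume : MeasureTheory.Measure (EuclideanSpace ℝ (Fin 3))), u₀ (WithLp.toLp 2 ![Real.cos (2 * Real.pi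 / p) * x 0 - Real.sin (2 * Real.pi / p) * x 1, Real.sin (2 * Real.pi / p) * x 0 + Real.cos (2 * Real.pi / p) * x 1, x 2]) = WithLp.toLp 2 ![Real.cos (2 * Real.pi / p) * u₀ x 0 - Real.sin (2 * Real.pi / p) * u₀ x 1, Real.sin (2 * Real.pi / p) * u₀ x 0 + Real.cos (2 * Real.pi / p) * u₀ x 1, u₀ x 2]) →
    (∀ ν : ℝ, 0 < ν → Literature.Analysis.FluidPDE.rusinSverakRhoMaxPure ν < ⊤ → ∀ p : ℕ, 2 ≤ p → (∀ ε : ENNReal, 0 < ε → ∃ (u₀ : EuclideanSpace ℝ (Fin 3) → EuclideanSpace ℝ (Fin 3)) (g : Literature.Analysis.FunctionSpaces.HomSobolev (EuclideanSpace ℝ (Fin 3)) (EuclideanSpace ℂ (Fin 3)) (1 / 2 : ℝ)), MeasureTheory.MemLp u₀ 3 (MeasureTheory.volume : MeasureTheory.Measure (EuclideanSpace ℝ (Fin 3))) ∧ g.Represents (Literature.Analysis.FunctionSpaces.EuclideanSpace.complexify ∘ u₀) ∧ Literature.Analysis.FluidPDE.IsWeaklyDivFree u₀ ∧ ¬ Literature.Analysis.FluidPDE.HasGlobalKatoSolution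 ν u₀ ∧ ‖g‖ₑ < Literature.Analysis.FluidPDE.rusinSverakRhoMaxPure ν + ε ∧ ∀ᵐ x ∂(MeasureTheory.volume : MeasureTheory.Measure (EuclideanSpace ℝ (Fin 3))), u₀ (WithLp.toLp 2 ![Real.cos (2 * Real.pi / p) * x 0 - Real.sin (2 * Real.pi / p) * x 1, Real.sin (2 * Real.pi / p) * x 0 + Real.cos (2 * Real.pi / p) * x 1, x 2]) = WithLp.toLp 2 ![Real.cos (2 * Real.pi / p) * u₀ x 0 - Real.sin (2 * Real.pi / p) * u₀ x 1, Real.sin (2 * Real.pi / p) * u₀ x 0 + Real.cos (2 * Real.pi / p) * u₀ x 1, u₀ x 2]) → ∃ (u₀ : EuclideanSpace ℝ (Fin 3) → EuclideanSpace ℝ (Fin 3)) (g : Literature.Analysis.FunctionSpaces.HomSobolev (EuclideanSpace ℝ (Fin 3)) (EuclideanSpace ℂ (Fin 3)) (1 / 2 : ℝ)), Literature.Analysis.FluidPDE.IsMinimalBlowupDatum ν u₀ g ∧ ∀ x : EuclideanSpace ℝ (Fin 3), u₀ (WithLp.toLp 2 ![Real.cos (2 * Real.pi / p) * x 0 - Real.sin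 (2 * Real.pi / p) * x 1, Real.sin (2 * Real.pi / p) * x 0 + Real.cos (2 * Real.pi / p) * x 1, x 2]) = WithLp.toLp 2 ![Real.cos (2 * Real.pi / p) * u₀ x 0 - Real.sin (2 * Real.pi / p) * u₀ x 1, Real.sin (2 * Real.pi / p) * u₀ x 0 + Real.cos (2 * Real.pi / p) * u₀ x 1, u₀ x 2]) →
      Summit.NavierStokesRegularity.NavierStokesRegularity.Theses.AxisymmetricExtremality.MinimalDatumPFold := by
  intro hA hB ν hν hclay N
  have hfin : Literature.Analysis.FluidPDE.rusinSverakRhoMaxPure ν < ⊤ :=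
    stub_thresholdFinite_of_clayFailure ν hν hclay
  obtain ⟨p, hNp, h2p, hfam⟩ := hA ν hν hclay N
  obtain ⟨u₀, g, hmin, hsym⟩ := hB ν hν hfin p h2p hfam
  exact ⟨p, hNp, h2p, u₀, g, hmin, hsym⟩

/-- **Exactness, easy direction**: the crux gives child 1 outright (a minimal datum has norm
`ρ_max^pure ν < ρ_max^pure ν + ε`, the threshold being finite under Clay failure, and pointwise ⇒ a.e.).
[cite: RusinSverak2011, Cor. 4.3 (arXiv:0911.0500 p. 8)] -/
theorem symmGapClosing_of_minimalDatumPFold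
    (h : Summit.NavierStokesRegularity.NavierStokesRegularity.Theses.AxisymmetricExtremality.MinimalDatumPFold) :
    ∀ ν : ℝ, 0 < ν → (∃ v₀ : EuclideanSpace ℝ (Fin 3) → EuclideanSpace ℝ (Fin 3), ContDiff ℝ (⊤ : ℕ∞) v₀ ∧ Literature.Analysis.FluidPDE.NSWave0.IsDivFree v₀ ∧ Literature.Analysis.FluidPDE.HasRapidSpatialDecay v₀ ∧ ¬ ∃ (u : ℝ → EuclideanSpace ℝ (Fin 3) → EuclideanSpace ℝ (Fin 3)) (p : ℝ → EuclideanSpace ℝ (Fin 3) → ℝ), Literature.Analysis.FluidPDE.IsSmoothOnHalfSpace u ∧ Literature.Analysis.FluidPDE.IsSmoothOnHalfSpace p ∧ Literature.Analysis.FluidPDE.IsNavierStokesSolution ν 0 v₀ u p ∧ Literature.Analysis.FluidPDE.HasBoundedEnergy u) → ∀ N : ℕ, ∃ p : ℕ, N ≤ p ∧ 2 ≤ p ∧ ∀ ε : ENNReal, 0 < ε → ∃ (u₀ : EuclideanSpace ℝ (Fin 3) → EuclideanSpace ℝ (Fin 3)) (g : Literature.Analysis.FunctionSpaces.HomSobolev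 (EuclideanSpace ℝ (Fin 3)) (EuclideanSpace ℂ (Fin 3)) (1 / 2 : ℝ)), MeasureTheory.MemLp u₀ 3 (MeasureTheory.volume : MeasureTheory.Measure (EuclideanSpace ℝ (Fin 3))) ∧ g.Represents (Literature.Analysis.FunctionSpaces.EuclideanSpace.complexify ∘ u₀) ∧ Literature.Analysis.FluidPDE.IsWeaklyDivFree u₀ ∧ ¬ Literature.Analysis.FluidPDE.HasGlobalKatoSolution ν u₀ ∧ ‖g‖ₑ < Literature.Analysis.FluidPDE.rusinSverakRhoMaxPure ν + ε ∧ ∀ᵐ x ∂(MeasureTheory.volume : MeasureTheory.Measure (EuclideanSpace ℝ (Fin 3))), u₀ (WithLp.toLp 2 ![Real.cos (2 * Real.pi / p) * x 0 - Real.sin (2 * Real.pi / p) * x 1, Real.sin (2 * Real.pi / p) * x 0 + Real.cos (2 * Real.pi / p) * x 1, x 2]) = WithLp.toLp 2 ![Real.cos (2 * Real.pi / p) * u₀ x 0 - Real.sin (2 * Real.pi / p) * u₀ x 1, Real.sin (2 * Real.pi / p) * u₀ x 0 + Real.cos (2 * Real.pi / p) * u₀ x 1, u₀ x 2] := by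
  intro ν hν hclay N
  have hfin : Literature.Analysis.FluidPDE.rusinSverakRhoMaxPure ν < ⊤ :=
    stub_thresholdFinite_of_clayFailure ν hν hclay
  obtain ⟨p, hNp, h2p, u₀, g, hmin, hsym⟩ := h ν hν hclay N
  refine ⟨p, hNp, h2p, fun ε hε => ⟨u₀, g, hmin.1, hmin.2.1, hmin.2.2.1, hmin.2.2.2.2, ?_, ?_⟩⟩
  · rw [hmin.2.2.2.1]
    exact ENNReal.lt_add_right hfin.ne hε.ne'
  · exact Filter.Eventually.of_forall hsym

end Summit.NavierStokesRegularity.NavierStokesRegularity.Theorems
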